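import Mathlib

/-!
# The tanh–sinh (double exponential) transformation of Takahasi and Mori

H. Takahasi and M. Mori, *Double Exponential Formulas for Numerical Integration*, Publ. RIMS
Kyoto Univ. **9** (1974) 721–741 (`TakahasiMori1974`) evaluate `I = ∫_{-1}^{1} f(x) dx` (3.1) by
the change of variable `x = φ(u)`, `φ(-∞) = -1`, `φ(∞) = 1` (1.4), which turns `I` into
`∫_{-∞}^{∞} g(u) du`, `g(u) = f(φ(u)) φ'(u)` (1.5)–(1.6), followed by the trapezoidal rule with
mesh `h`, `I_h = h Σ_{n=-∞}^{∞} f(φ(nh)) φ'(nh)` (1.7) ("obviously, the infinite sum must be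
appropriately truncated in actual application", p. 723).  Their double exponential choice for the
finite interval is `x = tanh((π/2) sinh u)` (3.2), giving the formula
`I_h = h Σ_n f(tanh((π/2) sinh nh)) · (π/2) cosh nh / cosh²((π/2) sinh nh)` (3.3), p. 734; near
the end points `1 ± x = exp(±(π/2) sinh u) / cosh((π/2) sinh u) ≃ 2 exp(±π sinh u)` as
`u → ∓∞` (3.13)–(3.14), p. 735, which is how `1 - x` is to be evaluated without cancellation;
and the truncation of the infinite sum at `u = ±Nh` costs about `|ΔI_t| ≃ exp(-(π/2) exp(Nh))`
(2.b.12), p. 732, the total error being the sum `ΔI = ΔI_h + ΔI_t` of the discretisation error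
of the infinite trapezoidal sum and this truncation error (§2).  L. N. Trefethen and
J. A. C. Weideman, *The Exponentially Convergent Trapezoidal Rule*, SIAM Review **56** (2014)
385–458 (`TrefethenWeideman2014`), §15, present the same rule with a parameter `μ > 0`:
`∫_{-1}^{1} y(ξ) dξ = ∫_{-∞}^{∞} y(φ(x)) φ'(x) dx ≈ h Σ_{k=-n}^{n} y(φ(kh)) φ'(kh)` (15.1), (15.7)
with `φ(x) = tanh(μ sinh x)`, `φ'(x) = μ cosh(x) sech²(μ sinh x)`, `N = 2n + 1` nodes, the
"tanh-sinh or DE rule" being `μ = π/2` (15.6); they estimate the truncation error by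
`φ'(nh) = O(exp(-(π/2) e^{nh}))` (discussion of (15.8)) and record
`∫_{-1}^{1} 1 dξ = (π/2) ∫_{-∞}^{∞} cosh(x) / cosh²((π/2) sinh x) dx` (15.11).

This file formalises the transformation and the **truncation** half of this error analysis,
for a general `μ` and for integrands `y` with values in a real normed space `F`.  (The
**discretisation** half — the error of the infinite trapezoidal sum `h Σ_{k ∈ ℤ} w(kh)` for `w`
holomorphic and integrable in a strip, [TrefethenWeideman2014, Thm. 5.1] — is
`Literature.Analysis.Quadrature.norm_tsum_sub_integral_le_of_strip`; the two are combined by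
`TanhSinh.norm_deRule_sub_integral_le` below, which takes any discretisation bound `δ` as a
hypothesis.)

* `TanhSinh.node μ x = tanh(μ sinh x)` and `TanhSinh.weight μ x = μ cosh x / cosh²(μ sinh x)`
  ((3.2)–(3.3), (15.6)–(15.7)); `TanhSinh.hasDerivAt_node` (`φ' = weight`), oddness / evenness
  (`node_neg`, `weight_neg`), `node_mem_Ioo`, `weight_pos`, `strictMono_node`,
  `range_node : range φ_μ = (-1, 1)`, `tendsto_node_atTop / atBot` (`φ(±∞) = ±1`, (1.4));
* the end-point identities `one_sub_node`, `one_add_node`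
  (`1 ∓ φ = e^{∓μ sinh x}/cosh(μ sinh x)`, (3.13)), their logistic forms `one_sub_node'`,
  `one_add_node'`, the bound `one_sub_node_le : 1 - φ_μ(x) ≤ 2 e^{-2μ sinh x}` ((3.14)) and the
  double exponential decay `exp_neg_two_mul_sinh_le : e^{-2μ sinh x} ≤ e^{μ} e^{-μ eˣ}` (`x ≥ 0`);
* `integral_weight_Ioi : ∫_T^∞ φ'_μ = 1 - φ_μ(T)`, `integral_weight_Iio`,
  `integral_weight : ∫_ℝ φ'_μ = 2` ((15.11)), `integrable_weight`, and the change of variables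
  `integral_weight_smul_comp_node : ∫_ℝ φ'_μ(x) • y(φ_μ(x)) dx = ∫_{-1}^{1} y(ξ) dξ` ((15.1),
  (1.4)–(1.6)) for every `y : ℝ → F` — no hypothesis on `y` is needed, both sides being Bochner
  integrals and `φ_μ` a `C¹` bijection `ℝ → (-1, 1)` (Mathlib's
  `MeasureTheory.integral_image_eq_integral_abs_deriv_smul`);
* truncation: `norm_integral_Ioi_weight_smul_le` / `…_Iio_…` (the transformed integral beyond
  `±T` has norm `≤ M (1 - φ_μ(T))` if `‖y‖ ≤ M` on `(-1, 1)`), and for the trapezoidal sums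
  `mul_sum_weight_le : h Σ_{i<m} φ'_μ(a + (i+1)h) ≤ 2 e^{-2μ sinh a}` (`μ ≥ 1/2`, `h > 0`, any
  `a`, any `m`), `norm_smul_sum_weight_smul_le` (the same with `• y(φ_μ(·))` and a factor `M`),
  proved with the decreasing majorant `4μ cosh x · e^{-2μ sinh x} ≥ φ'_μ(x)` whose primitive is
  `-2 e^{-2μ sinh x}` — a rigorous version of the estimate (2.b.12);
* the rule `TanhSinh.deRule μ h n y = h Σ_{k=-n}^{n} φ'_μ(kh) • y(φ_μ(kh))` ((3.3), (15.7)),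
  `tendsto_deRule` (its limit `n → ∞` is the infinite trapezoidal sum when that is summable),
  the truncation bounds `norm_deRule_add_sub_deRule_le`, `norm_tsum_sub_deRule_le`
  (`‖h Σ_{k ∈ ℤ} - I_h^{(n)}‖ ≤ 4M e^{-2μ sinh(nh)}`), and the decomposition
  `norm_deRule_sub_integral_le : ‖I_h^{(n)}(y) - ∫_{-1}^{1} y‖ ≤ δ + 4M e^{-2μ sinh(nh)}`
  (`ΔI = ΔI_h + ΔI_t`, §2 of [TakahasiMori1974]);
* the unit-interval form `TanhSinh.unitNode μ t = (1 + φ_μ(t))/2 = 1/(1 + e^{-2μ sinh t})`,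
  `TanhSinh.unitWeight μ t = φ'_μ(t)/2`: `unitNode_eq`, `unitNode_eq'` (logistic forms),
  `one_sub_unitNode : 1 - x_μ(t) = x_μ(-t)`, `one_sub_unitNode_eq`
  (`= e^{-2μ sinh t}/(1 + e^{-2μ sinh t})`, the cancellation-free complement of (3.13)),
  `one_sub_unitNode_eq_inv`, `hasDerivAt_unitNode`, `integral_unitWeight = 1`,
  `integral_unitWeight_Ioi : ∫_T^∞ x'_μ = 1 - x_μ(T)`,
  `integral_unitWeight_smul_comp_unitNode : ∫_ℝ x'_μ(t) • g(x_μ(t)) dt = ∫_0^1 g`,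
  `mul_sum_unitWeight_le`; and the standard parameter `μ = π/2`: `unitNode_pi_div_two`
  (`x = 1/(1 + e^{-π sinh t})`), `one_sub_unitNode_pi_div_two`, `unitWeight_pi_div_two`
  (`x' = (π/4) cosh t / cosh²((π/2) sinh t)`), `one_sub_node_pi_div_two_le`.

Design choices.  The parameter `μ` is kept general as in [TrefethenWeideman2014, (15.7)]
([TakahasiMori1974]: `μ = π/2`); the trapezoidal-sum truncation bounds assume `μ ≥ 1/2`, which
makes the majorant decreasing on all of `ℝ` and covers `μ = π/2`.  Sums over `k = -n, …, n` are
over `Finset.Icc (-n : ℤ) n`; the infinite trapezoidal sum is `h • ∑' k : ℤ`, as in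
`TrapezoidalRuleRealLine.lean`.

Not formalised here: the optimality of `μ = π/2` and the strip-of-analyticity discussion of the
transformed integrand ([TrefethenWeideman2014, §15]; [TakahasiMori1974, §2 (b)]), the step-size
rules (15.8)–(15.10) / (2.b.13)–(2.b.15), the contour-integral error representation (1.8)–(1.9)
and the "characteristic function" analysis of [TakahasiMori1974, §2], the double exponential maps
(3.4)–(3.12) for half-infinite and infinite intervals, and all floating-point aspects.

References: H. Takahasi, M. Mori, *Double Exponential Formulas for Numerical Integration*,
Publ. Res. Inst. Math. Sci. 9 (1974) 721–741, doi:10.2977/prims/1195192451 (`TakahasiMori1974`);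
L. N. Trefethen, J. A. C. Weideman, *The Exponentially Convergent Trapezoidal Rule*, SIAM Rev.
56 (2014) 385–458, doi:10.1137/130932132 (`TrefethenWeideman2014`), §15.

Engine use: these are the map, weights, complements `1 - x` and truncation tails behind the
DE / tanh–sinh grids of `certquad` in the engines tree; rigour of any published number stays
with the client cell's verifiers.

AI-produced formalisation (H21 engines group, seat eng-quad-2, 2026-08-21); no facts, no axioms
beyond Mathlib's, no `sorry`.
-/

open Real MeasureTheory Set Filter Topology
open scoped Topology

namespace Literature.Analysis.Quadrature.TanhSinh

noncomputable section

/-- The tanh–sinh map `φ(x) = tanh(μ sinh x)` from `ℝ` onto `(-1, 1)`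
([cite: TakahasiMori1974, Eq. (3.2)] with `μ = π/2`;
[cite: TrefethenWeideman2014, Eq. (15.6)–(15.7)] for general `μ > 0`). -/
def node (μ x : ℝ) : ℝ := Real.tanh (μ * Real.sinh x)

/-- The tanh–sinh weight `φ'(x) = μ cosh(x) / cosh²(μ sinh x)`
([cite: TakahasiMori1974, Eq. (3.3)]; [cite: TrefethenWeideman2014, Eq. (15.7)]). -/
def weight (μ x : ℝ) : ℝ := μ * Real.cosh x / Real.cosh (μ * Real.sinh x) ^ 2

variable {μ : ℝ}

/-- `tanh = sinh / cosh` written for the node. [cite: TrefethenWeideman2014, Eq. (15.6)] -/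
theorem node_eq_sinh_div_cosh (μ x : ℝ) :
    node μ x = Real.sinh (μ * Real.sinh x) / Real.cosh (μ * Real.sinh x) := by
  simp [node, Real.tanh_eq_sinh_div_cosh]

/-- The derivative of `tanh`, in the form `1 / cosh²`. [folklore] -/
private theorem hasDerivAt_tanh' (y : ℝ) :
    HasDerivAt (fun y => Real.sinh y / Real.cosh y) (1 / Real.cosh y ^ 2) y := by
  have hc : Real.cosh y ≠ 0 := (Real.cosh_pos y).ne'
  have h := (Real.hasDerivAt_sinh y).div (Real.hasDerivAt_cosh y) hc
  have key : Real.cosh y * Real.cosh y - Real.sinh y * Real.sinh y = 1 := by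
    have := Real.cosh_sq y
    nlinarith
  rw [key] at h
  exact h

/-- `φ' = weight`: the node map is differentiable with derivative the weight
([cite: TrefethenWeideman2014, Eq. (15.7)]: `φ'(x) = μ cosh(x) sech²(μ sinh(x))`). -/
theorem hasDerivAt_node (μ x : ℝ) : HasDerivAt (node μ) (weight μ x) x := by
  have hin : HasDerivAt (fun x => μ * Real.sinh x) (μ * Real.cosh x) x :=
    (Real.hasDerivAt_sinh x).const_mul μ
  have hout := hasDerivAt_tanh' (μ * Real.sinh x)
  have hcomp := hout.comp x hin
  have hfun : node μ = (fun y => Real.sinh y / Real.cosh y) ∘ fun x => μ * Real.sinh x := by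
    funext t
    simp [node, Real.tanh_eq_sinh_div_cosh]
  have heq : 1 / Real.cosh (μ * Real.sinh x) ^ 2 * (μ * Real.cosh x) = weight μ x := by
    unfold weight
    ring
  rw [hfun, ← heq]
  exact hcomp

/-- `dφ_μ/dx = φ'_μ`. [cite: TrefethenWeideman2014, Eq. (15.7)] -/
theorem deriv_node (μ x : ℝ) : deriv (node μ) x = weight μ x := (hasDerivAt_node μ x).deriv

/-- The node map is differentiable. [cite: TrefethenWeideman2014, Eq. (15.7)] -/
theorem differentiable_node (μ : ℝ) : Differentiable ℝ (node μ) :=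
  fun x => (hasDerivAt_node μ x).differentiableAt

/-- The node map is continuous. [cite: TrefethenWeideman2014, Eq. (15.7)] -/
theorem continuous_node (μ : ℝ) : Continuous (node μ) := (differentiable_node μ).continuous

/-- The weight is continuous. [cite: TrefethenWeideman2014, Eq. (15.7)] -/
theorem continuous_weight (μ : ℝ) : Continuous (weight μ) := by
  unfold weight
  refine Continuous.div (continuous_const.mul Real.continuous_cosh)
    ((Real.continuous_cosh.comp (continuous_const.mul Real.continuous_sinh)).pow 2) ?_
  intro x
  exact pow_ne_zero 2 (Real.cosh_pos _).ne'

/-- The node map is odd ([cite: TakahasiMori1974, §3]: the rule is symmetric under `u ↦ -u`). -/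
theorem node_neg (μ x : ℝ) : node μ (-x) = -node μ x := by
  simp [node, Real.sinh_neg, Real.tanh_neg]

/-- The weight is even. [cite: TakahasiMori1974, §3] -/
theorem weight_neg (μ x : ℝ) : weight μ (-x) = weight μ x := by
  simp [weight, Real.sinh_neg, Real.cosh_neg]

/-- `φ_μ(0) = 0` (the midpoint node). [cite: TakahasiMori1974, Eq. (3.2)] -/
@[simp] theorem node_zero (μ : ℝ) : node μ 0 = 0 := by simp [node]

/-- `φ_μ(x) < 1`. [cite: TakahasiMori1974, Eq. (3.13)] -/
theorem node_lt_one (μ x : ℝ) : node μ x < 1 := Real.tanh_lt_one _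

/-- `-1 < φ_μ(x)`. [cite: TakahasiMori1974, Eq. (3.13)] -/
theorem neg_one_lt_node (μ x : ℝ) : -1 < node μ x := Real.neg_one_lt_tanh _

/-- `|φ_μ(x)| < 1`. [cite: TakahasiMori1974, Eq. (3.13)] -/
theorem abs_node_lt_one (μ x : ℝ) : |node μ x| < 1 :=
  abs_lt.2 ⟨neg_one_lt_node μ x, node_lt_one μ x⟩

/-- The nodes lie in the open interval `(-1, 1)` ([cite: TakahasiMori1974, Eqs. (3.1)–(3.2)];
[cite: TrefethenWeideman2014, §15]: "a mapping `ξ = φ(x)` from `ℝ` to `[-1, 1]`"). -/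
theorem node_mem_Ioo (μ x : ℝ) : node μ x ∈ Ioo (-1 : ℝ) 1 := ⟨neg_one_lt_node μ x, node_lt_one μ x⟩

/-- The weights are positive (`μ > 0`). [cite: TrefethenWeideman2014, Eq. (15.7)] -/
theorem weight_pos (hμ : 0 < μ) (x : ℝ) : 0 < weight μ x := by
  unfold weight
  exact div_pos (mul_pos hμ (Real.cosh_pos x)) (pow_pos (Real.cosh_pos _) 2)

/-- The weights are nonnegative (`μ ≥ 0`). [cite: TrefethenWeideman2014, Eq. (15.7)] -/
theorem weight_nonneg (hμ : 0 ≤ μ) (x : ℝ) : 0 ≤ weight μ x := by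
  unfold weight
  exact div_nonneg (mul_nonneg hμ (Real.cosh_pos x).le) (pow_nonneg (Real.cosh_pos _).le 2)

/-- For `μ > 0` the node map is strictly increasing. [cite: TrefethenWeideman2014, §15] -/
theorem strictMono_node (hμ : 0 < μ) : StrictMono (node μ) :=
  strictMono_of_deriv_pos fun x => by rw [deriv_node]; exact weight_pos hμ x

/-- The node map is injective (`μ > 0`). [cite: TrefethenWeideman2014, §15] -/
theorem injective_node (hμ : 0 < μ) : Function.Injective (node μ) := (strictMono_node hμ).injective

/-! ### Cancellation-free forms of the nodes ([cite: TakahasiMori1974, Eq. (3.13)]) -/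

/-- `1 - tanh y = e^{-y} / cosh y`. [folklore] -/
private theorem one_sub_tanh_eq (y : ℝ) : 1 - Real.tanh y = Real.exp (-y) / Real.cosh y := by
  have hc : Real.cosh y ≠ 0 := (Real.cosh_pos y).ne'
  rw [Real.tanh_eq_sinh_div_cosh, eq_div_iff hc, sub_mul, div_mul_cancel₀ _ hc, Real.cosh_eq,
    Real.sinh_eq]
  ring

/-- `1 + tanh y = e^{y} / cosh y`. [folklore] -/
private theorem one_add_tanh_eq (y : ℝ) : 1 + Real.tanh y = Real.exp y / Real.cosh y := by
  have hc : Real.cosh y ≠ 0 := (Real.cosh_pos y).ne'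
  rw [Real.tanh_eq_sinh_div_cosh, eq_div_iff hc, add_mul, div_mul_cancel₀ _ hc, Real.cosh_eq,
    Real.sinh_eq]
  ring

/-- `cosh y = e^{-y} (e^{2y} + 1) / 2`. [folklore] -/
private theorem cosh_eq_exp_neg_mul (y : ℝ) :
    Real.cosh y = Real.exp (-y) * (Real.exp (2 * y) + 1) / 2 := by
  rw [Real.cosh_eq, mul_add, mul_one, ← Real.exp_add]
  ring_nf

/-- Takahasi–Mori's cancellation-free complement at the right end point:
`1 - φ(u) = exp(-μ sinh u) / cosh(μ sinh u)` ([cite: TakahasiMori1974, Eq. (3.13)], upper signs,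
there with `μ = π/2`). -/
theorem one_sub_node (μ x : ℝ) :
    1 - node μ x = Real.exp (-(μ * Real.sinh x)) / Real.cosh (μ * Real.sinh x) := by
  simp [node, one_sub_tanh_eq]

/-- The left end point: `1 + φ(u) = exp(μ sinh u) / cosh(μ sinh u)`
([cite: TakahasiMori1974, Eq. (3.13)], lower signs). -/
theorem one_add_node (μ x : ℝ) :
    1 + node μ x = Real.exp (μ * Real.sinh x) / Real.cosh (μ * Real.sinh x) := by
  simp [node, one_add_tanh_eq]

/-- The same complement as a logistic expression: `1 - φ(u) = 2 / (exp(2 μ sinh u) + 1)`.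
[cite: TakahasiMori1974, Eq. (3.13)] -/
theorem one_sub_node' (μ x : ℝ) :
    1 - node μ x = 2 / (Real.exp (2 * (μ * Real.sinh x)) + 1) := by
  rw [one_sub_node, cosh_eq_exp_neg_mul]
  have h1 : Real.exp (-(μ * Real.sinh x)) ≠ 0 := (Real.exp_pos _).ne'
  have h2 : Real.exp (2 * (μ * Real.sinh x)) + 1 ≠ 0 := by positivity
  field_simp

/-- `1 + φ(u) = 2 / (exp(-2 μ sinh u) + 1)`. [cite: TakahasiMori1974, Eq. (3.13)] -/
theorem one_add_node' (μ x : ℝ) :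
    1 + node μ x = 2 / (Real.exp (-(2 * (μ * Real.sinh x))) + 1) := by
  have := one_sub_node' μ (-x)
  rw [node_neg, sub_neg_eq_add, Real.sinh_neg] at this
  rw [this]
  ring_nf

/-- Takahasi–Mori's asymptotic `1 ∓ x ≃ 2 exp(∓ π sinh u)` ([cite: TakahasiMori1974, Eq. (3.14)])
as the inequality `1 - φ(u) ≤ 2 exp(-2 μ sinh u)`, valid for every `u`. -/
theorem one_sub_node_le (μ x : ℝ) :
    1 - node μ x ≤ 2 * Real.exp (-(2 * (μ * Real.sinh x))) := by
  rw [one_sub_node', Real.exp_neg, div_eq_mul_inv]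
  gcongr
  · exact le_add_of_nonneg_right zero_le_one

/-- … and the matching lower bound `exp(-2 μ sinh u) ≤ 1 - φ(u)` once `μ sinh u ≥ 0`, so that
`1 - φ(u)` and `2 exp(-2 μ sinh u)` agree within a factor of two
([cite: TakahasiMori1974, Eq. (3.14)]). -/
theorem exp_le_one_sub_node {x : ℝ} (h : 0 ≤ μ * Real.sinh x) :
    Real.exp (-(2 * (μ * Real.sinh x))) ≤ 1 - node μ x := by
  have h1 : (1 : ℝ) ≤ Real.exp (2 * (μ * Real.sinh x)) := Real.one_le_exp (by positivity)
  have h2 : 0 < Real.exp (2 * (μ * Real.sinh x)) := Real.exp_pos _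
  rw [one_sub_node', Real.exp_neg, inv_eq_one_div, div_le_div_iff₀ h2 (by positivity)]
  nlinarith

/-- The double-exponential form of the decay: for `u ≥ 0` and `μ ≥ 0`,
`exp(-2 μ sinh u) ≤ e^{μ} exp(-μ e^{u})` ([cite: TakahasiMori1974, Eq. (2.b.12)];
[cite: TrefethenWeideman2014, §15]: "the truncation error can be estimated as
`φ'(nh) = O(exp(-½ π e^{nh}))`"). -/
theorem exp_neg_two_mul_sinh_le (hμ : 0 ≤ μ) {x : ℝ} (hx : 0 ≤ x) :
    Real.exp (-(2 * (μ * Real.sinh x))) ≤ Real.exp μ * Real.exp (-(μ * Real.exp x)) := by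
  rw [← Real.exp_add, Real.exp_le_exp, Real.sinh_eq]
  have h1 : Real.exp (-x) ≤ 1 := by rw [Real.exp_le_one_iff]; linarith
  nlinarith [Real.exp_pos x]

/-! ### Limits and range -/

/-- `φ(x) → 1` as `x → +∞`. [cite: TrefethenWeideman2014, §15] -/
theorem tendsto_node_atTop (hμ : 0 < μ) : Tendsto (node μ) atTop (𝓝 1) := by
  -- squeeze `1 - 2 exp(-2 μ x) ≤ node μ x ≤ 1` for `x ≥ 0`
  have hlow : Tendsto (fun x : ℝ => 1 - 2 * Real.exp (-(2 * μ * x))) atTop (𝓝 1) := by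
    have h1 : Tendsto (fun x : ℝ => 2 * μ * x) atTop atTop :=
      tendsto_id.const_mul_atTop (by positivity)
    have h2 : Tendsto (fun x : ℝ => Real.exp (-(2 * μ * x))) atTop (𝓝 0) :=
      Real.tendsto_exp_neg_atTop_nhds_zero.comp h1
    have h3 := h2.const_mul 2
    have h4 := h3.const_sub 1
    simpa using h4
  refine tendsto_of_tendsto_of_tendsto_of_le_of_le' hlow tendsto_const_nhds ?_ ?_
  · filter_upwards [eventually_ge_atTop (0 : ℝ)] with x hx
    have hs : x ≤ Real.sinh x := Real.self_le_sinh_iff.2 hx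
    have hb := one_sub_node_le μ x
    have hm : Real.exp (-(2 * (μ * Real.sinh x))) ≤ Real.exp (-(2 * μ * x)) := by
      rw [Real.exp_le_exp]; nlinarith
    linarith
  · exact Eventually.of_forall fun x => (node_lt_one μ x).le

/-- `φ(x) → -1` as `x → -∞`. [cite: TrefethenWeideman2014, §15] -/
theorem tendsto_node_atBot (hμ : 0 < μ) : Tendsto (node μ) atBot (𝓝 (-1)) := by
  have h := (tendsto_node_atTop hμ).comp tendsto_neg_atBot_atTop
  have h2 := h.neg
  refine (tendsto_congr fun x => ?_).1 h2
  simp [Function.comp, node_neg]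

/-- The tanh–sinh map is a bijection of `ℝ` onto the open interval `(-1, 1)`
([cite: TrefethenWeideman2014, §15]: "a mapping `ξ = φ(x)` from `ℝ` to `[-1, 1]`"). -/
theorem range_node (hμ : 0 < μ) : range (node μ) = Ioo (-1 : ℝ) 1 := by
  refine Subset.antisymm (range_subset_iff.2 (node_mem_Ioo μ)) fun y hy => ?_
  obtain ⟨b, hb⟩ : ∃ b, y < node μ b := by
    have := (tendsto_node_atTop hμ).eventually (eventually_gt_nhds hy.2)
    exact this.exists
  obtain ⟨a, ha⟩ : ∃ a, node μ a < y := by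
    have := (tendsto_node_atBot hμ).eventually (eventually_lt_nhds hy.1)
    exact this.exists
  have hab : a ≤ b := by
    by_contra h
    have := (strictMono_node hμ) (lt_of_not_ge h)
    linarith
  have hivt := intermediate_value_Icc hab (continuous_node μ).continuousOn
  obtain ⟨x, -, hx⟩ := hivt ⟨ha.le, hb.le⟩
  exact ⟨x, hx⟩


/-! ### Integrals of the weight and the change of variables -/

/-- The weight is integrable on every right half-line (it is the derivative of the bounded
increasing node map). [cite: TrefethenWeideman2014, Eq. (15.11)] -/
theorem integrableOn_weight_Ioi (hμ : 0 < μ) (T : ℝ) : IntegrableOn (weight μ) (Ioi T) :=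
  integrableOn_Ioi_deriv_of_nonneg (continuous_node μ).continuousWithinAt
    (fun x _ => hasDerivAt_node μ x) (fun x _ => (weight_pos hμ x).le) (tendsto_node_atTop hμ)

/-- The neglected right tail of the transformed integral of `y ≡ 1`:
`∫_T^∞ φ'(x) dx = 1 - φ(T)` ([cite: TakahasiMori1974, Eq. (2.b.12)]: the truncation error of the
infinite trapezoidal sum at `±Nh`; [cite: TrefethenWeideman2014, §15]). -/
theorem integral_weight_Ioi (hμ : 0 < μ) (T : ℝ) : ∫ x in Ioi T, weight μ x = 1 - node μ T :=
  integral_Ioi_of_hasDerivAt_of_nonneg (continuous_node μ).continuousWithinAt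
    (fun x _ => hasDerivAt_node μ x) (fun x _ => (weight_pos hμ x).le) (tendsto_node_atTop hμ)

variable {F : Type*} [NormedAddCommGroup F] [NormedSpace ℝ F]

/-- **The tanh–sinh change of variables** `∫_{-1}^{1} y(ξ) dξ = ∫_{-∞}^{∞} y(φ(x)) φ'(x) dx`
([cite: TrefethenWeideman2014, Eq. (15.1)]; [cite: TakahasiMori1974, Eq. (1.4)–(1.5) and §3 (a)]),
for an arbitrary integrand `y` (both sides are Bochner integrals; no integrability hypothesis is
needed because the map is a `C¹` bijection of `ℝ` onto `(-1, 1)`). -/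
theorem integral_weight_smul_comp_node (hμ : 0 < μ) (y : ℝ → F) :
    ∫ x, weight μ x • y (node μ x) = ∫ ξ in (-1:ℝ)..1, y ξ := by
  have h := integral_image_eq_integral_abs_deriv_smul (f := node μ) (f' := weight μ)
    MeasurableSet.univ (fun x _ => (hasDerivAt_node μ x).hasDerivWithinAt)
    (injective_node hμ).injOn y
  rw [image_univ, range_node hμ, Measure.restrict_univ] at h
  rw [intervalIntegral.integral_of_le (by norm_num), integral_Ioc_eq_integral_Ioo, h]
  refine integral_congr_ae (Eventually.of_forall fun x => ?_)
  simp [abs_of_pos (weight_pos hμ x)]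

/-- `∫_{-∞}^{∞} φ'(x) dx = 2 = ∫_{-1}^{1} dξ` ([cite: TrefethenWeideman2014, Eq. (15.11)]:
"the integration of a constant function"). -/
theorem integral_weight (hμ : 0 < μ) : ∫ x, weight μ x = 2 := by
  have h := integral_weight_smul_comp_node hμ (fun _ => (1 : ℝ))
  simp only [smul_eq_mul, mul_one, intervalIntegral.integral_const] at h
  rw [h]
  norm_num

/-- The weight is integrable on `ℝ`. [cite: TrefethenWeideman2014, Eq. (15.11)] -/
theorem integrable_weight (hμ : 0 < μ) : Integrable (weight μ) := by
  by_contra h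
  have h2 := integral_weight hμ
  rw [integral_undef h] at h2
  norm_num at h2

/-- The left tail, by symmetry: `∫_{-∞}^{-T} φ' = 1 - φ(T)`.
[cite: TakahasiMori1974, Eq. (2.b.12)] -/
theorem integral_weight_Iio (hμ : 0 < μ) (T : ℝ) : ∫ x in Iio (-T), weight μ x = 1 - node μ T := by
  have h1 : ∫ x in Iic (-T), weight μ x = ∫ x in Iio (-T), weight μ x :=
    integral_Iic_eq_integral_Iio
  have h2 : (∫ x in Iic (-T), weight μ x) + ∫ x in Ioi (-T), weight μ x = ∫ x, weight μ x :=
    intervalIntegral.integral_Iic_add_Ioi (integrable_weight hμ).integrableOn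
      (integrable_weight hμ).integrableOn
  rw [integral_weight hμ, integral_weight_Ioi hμ, node_neg] at h2
  linarith

/-- Truncating the transformed integral: for an integrand bounded by `M` on `(-1, 1)` the part of
`∫ y(φ(x)) φ'(x) dx` over `x > T` has norm at most `M (1 - φ(T))`
([cite: TakahasiMori1974, p. 724 and Eq. (2.b.12)]: the error `ΔI_t` "caused by the truncation
of the infinite sum"; [cite: TrefethenWeideman2014, §15]). -/
theorem norm_integral_Ioi_weight_smul_le (hμ : 0 < μ) {y : ℝ → F} {M : ℝ}
    (hM : ∀ ξ ∈ Ioo (-1:ℝ) 1, ‖y ξ‖ ≤ M) (T : ℝ) :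
    ‖∫ x in Ioi T, weight μ x • y (node μ x)‖ ≤ M * (1 - node μ T) := by
  calc ‖∫ x in Ioi T, weight μ x • y (node μ x)‖ ≤ ∫ x in Ioi T, M * weight μ x := by
        refine norm_integral_le_of_norm_le ((integrableOn_weight_Ioi hμ T).const_mul M)
          (Eventually.of_forall fun x => ?_)
        rw [norm_smul, Real.norm_of_nonneg (weight_pos hμ x).le, mul_comm]
        exact mul_le_mul_of_nonneg_right (hM _ (node_mem_Ioo μ x)) (weight_pos hμ x).le
    _ = M * (1 - node μ T) := by rw [integral_const_mul, integral_weight_Ioi hμ]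

/-- … and likewise over `x < -T`. [cite: TakahasiMori1974, Eq. (2.b.12)] -/
theorem norm_integral_Iio_weight_smul_le (hμ : 0 < μ) {y : ℝ → F} {M : ℝ}
    (hM : ∀ ξ ∈ Ioo (-1:ℝ) 1, ‖y ξ‖ ≤ M) (T : ℝ) :
    ‖∫ x in Iio (-T), weight μ x • y (node μ x)‖ ≤ M * (1 - node μ T) := by
  have hint : IntegrableOn (weight μ) (Iio (-T)) := (integrable_weight hμ).integrableOn
  calc ‖∫ x in Iio (-T), weight μ x • y (node μ x)‖ ≤ ∫ x in Iio (-T), M * weight μ x := by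
        refine norm_integral_le_of_norm_le (hint.const_mul M) (Eventually.of_forall fun x => ?_)
        rw [norm_smul, Real.norm_of_nonneg (weight_pos hμ x).le, mul_comm]
        exact mul_le_mul_of_nonneg_right (hM _ (node_mem_Ioo μ x)) (weight_pos hμ x).le
    _ = M * (1 - node μ T) := by rw [integral_const_mul, integral_weight_Iio hμ]


/-! ### Truncation of the trapezoidal sum: the discrete tails

[cite: TakahasiMori1974, §2 (b), Eq. (2.b.12)] estimates the truncation error of the infinite sum
`h Σ_{k ∈ ℤ}` at `|k| ≤ N` by the size of the first neglected terms, `exp(-(π/2) exp(Nh))`.  We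
make this rigorous with the decreasing majorant `m(x) = 4μ cosh x · e^{-2μ sinh x} ≥ φ'_μ(x)`
(from `sech² s ≤ 4 e^{-2s}`), whose primitive is `-2 e^{-2μ sinh x}`: a right Riemann sum of a
decreasing function is below its integral. -/

/-- The majorant `m(x) = 4μ cosh x · exp(-2μ sinh x)` of the weight. [folklore] -/
private def maj (μ x : ℝ) : ℝ := 4 * μ * Real.cosh x * Real.exp (-(2 * (μ * Real.sinh x)))

/-- `sech² s ≤ 4 e^{-2s}`, in the form `1/4 ≤ e^{-2s} cosh² s`. [folklore] -/
private theorem quarter_le_exp_mul_cosh_sq (s : ℝ) :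
    1 / 4 ≤ Real.exp (-(2 * s)) * Real.cosh s ^ 2 := by
  have h1 : Real.exp (-s) * Real.cosh s = (1 + Real.exp (-s) ^ 2) / 2 := by
    rw [Real.cosh_eq, sq, mul_div_assoc', mul_add, ← Real.exp_add, neg_add_cancel, Real.exp_zero]
  have h2 : Real.exp (-(2 * s)) = Real.exp (-s) ^ 2 := by
    rw [sq, ← Real.exp_add]; congr 1; ring
  rw [h2, ← mul_pow, h1]
  have h3 : (1:ℝ) / 2 ≤ (1 + Real.exp (-s) ^ 2) / 2 := by linarith [sq_nonneg (Real.exp (-s))]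
  nlinarith [h3]

/-- `φ'_μ ≤ m` for `μ ≥ 0`. [folklore] -/
private theorem weight_le_maj (hμ : 0 ≤ μ) (x : ℝ) : weight μ x ≤ maj μ x := by
  unfold weight maj
  have hc := Real.cosh_pos (μ * Real.sinh x)
  rw [div_le_iff₀ (pow_pos hc 2)]
  have hq := quarter_le_exp_mul_cosh_sq (μ * Real.sinh x)
  have h0 : 0 ≤ μ * Real.cosh x := mul_nonneg hμ (Real.cosh_pos x).le
  calc μ * Real.cosh x = 4 * (μ * Real.cosh x) * (1 / 4) := by ring
    _ ≤ 4 * (μ * Real.cosh x) *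
        (Real.exp (-(2 * (μ * Real.sinh x))) * Real.cosh (μ * Real.sinh x) ^ 2) :=
        mul_le_mul_of_nonneg_left hq (by positivity)
    _ = 4 * μ * Real.cosh x * Real.exp (-(2 * (μ * Real.sinh x))) *
        Real.cosh (μ * Real.sinh x) ^ 2 := by ring

/-- Derivative of `e^{-2μ sinh x}`. [folklore] -/
private theorem hasDerivAt_exp_neg_two_mul_sinh (μ x : ℝ) :
    HasDerivAt (fun x => Real.exp (-(2 * (μ * Real.sinh x))))
      (Real.exp (-(2 * (μ * Real.sinh x))) * (-(2 * (μ * Real.cosh x)))) x :=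
  (((Real.hasDerivAt_sinh x).const_mul μ).const_mul 2).neg.exp

/-- Derivative of the majorant: `m'(x) = 4μ e^{-2μ sinh x} (sinh x - 2μ cosh² x)`. [folklore] -/
private theorem hasDerivAt_maj (μ x : ℝ) :
    HasDerivAt (maj μ) (4 * μ * Real.exp (-(2 * (μ * Real.sinh x))) *
      (Real.sinh x - 2 * μ * Real.cosh x ^ 2)) x := by
  have h := ((Real.hasDerivAt_cosh x).mul (hasDerivAt_exp_neg_two_mul_sinh μ x)).const_mul (4 * μ)
  have hfun : maj μ = fun x => 4 * μ * (Real.cosh x * Real.exp (-(2 * (μ * Real.sinh x)))) := by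
    funext x; simp only [maj]; ring
  rw [hfun]
  exact h.congr_deriv (by ring)

/-- `-2 e^{-2μ sinh x}` is a primitive of the majorant. [folklore] -/
private theorem hasDerivAt_primitive_maj (μ x : ℝ) :
    HasDerivAt (fun x => -2 * Real.exp (-(2 * (μ * Real.sinh x)))) (maj μ x) x := by
  refine ((hasDerivAt_exp_neg_two_mul_sinh μ x).const_mul (-2)).congr_deriv ?_
  simp only [maj]; ring

/-- The majorant is continuous. [folklore] -/
private theorem continuous_maj (μ : ℝ) : Continuous (maj μ) := by
  unfold maj; fun_prop

/-- For `μ ≥ 1/2` the majorant is decreasing on all of `ℝ`. [folklore] -/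
private theorem antitone_maj (hμ : 1 / 2 ≤ μ) : Antitone (maj μ) := by
  refine antitone_of_deriv_nonpos (fun x => (hasDerivAt_maj μ x).differentiableAt) fun x => ?_
  rw [(hasDerivAt_maj μ x).deriv]
  have hc := Real.one_le_cosh x
  have hc0 : 0 ≤ Real.cosh x := (Real.cosh_pos x).le
  have hs := (Real.sinh_lt_cosh x).le
  have h3 : Real.cosh x ≤ Real.cosh x ^ 2 := by nlinarith
  have h4 : Real.cosh x ^ 2 ≤ 2 * μ * Real.cosh x ^ 2 := by nlinarith [sq_nonneg (Real.cosh x)]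
  have h5 : 0 ≤ 4 * μ * Real.exp (-(2 * (μ * Real.sinh x))) := by
    have : 0 ≤ μ := by linarith
    positivity
  exact mul_nonpos_iff.mpr (Or.inl ⟨h5, by linarith⟩)

/-- `∫_a^b m = 2 e^{-2μ sinh a} - 2 e^{-2μ sinh b}`. [folklore] -/
private theorem integral_maj (μ a b : ℝ) :
    ∫ x in a..b, maj μ x =
      2 * Real.exp (-(2 * (μ * Real.sinh a))) - 2 * Real.exp (-(2 * (μ * Real.sinh b))) := by
  rw [intervalIntegral.integral_eq_sub_of_hasDerivAt (fun x _ => hasDerivAt_primitive_maj μ x)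
    ((continuous_maj μ).intervalIntegrable a b)]
  ring

/-- One cell of the right Riemann sum of the decreasing majorant is below its integral:
`(b - a) m(b) ≤ ∫_a^b m`. [folklore] -/
private theorem mul_maj_le_integral (hμ : 1 / 2 ≤ μ) {a b : ℝ} (hab : a ≤ b) :
    (b - a) * maj μ b ≤ ∫ x in a..b, maj μ x := by
  have h := intervalIntegral.integral_mono_on hab
    (intervalIntegrable_const : IntervalIntegrable (fun _ => maj μ b) volume a b)
    ((continuous_maj μ).intervalIntegrable a b) (fun x hx => antitone_maj hμ hx.2)
  rwa [intervalIntegral.integral_const, smul_eq_mul] at h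

/-- **Right tail of the trapezoidal sum of the weights.**  For `μ ≥ 1/2`, `h > 0` and any `a`,
`h Σ_{i<m} φ'_μ(a + (i+1)h) ≤ 2 e^{-2μ sinh a}`; with `μ = π/2` and `a = Nh` this is the
double-exponentially small `2 e^{-π sinh(Nh)} ≤ 2e^{π/2} exp(-(π/2) e^{Nh})` of
[cite: TakahasiMori1974, Eq. (2.b.12)] (there the estimate `|ΔI_t| ≃ exp(-(π/2) exp(Nh))`; here a
rigorous bound via the decreasing majorant `4μ cosh x · e^{-2μ sinh x}`). -/
theorem mul_sum_weight_le (hμ : 1 / 2 ≤ μ) {h : ℝ} (hh : 0 < h) (a : ℝ) (m : ℕ) :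
    h * ∑ i ∈ Finset.range m, weight μ (a + (i + 1) * h) ≤
      2 * Real.exp (-(2 * (μ * Real.sinh a))) := by
  have hμ0 : 0 ≤ μ := by linarith
  have hcell : ∀ i ∈ Finset.range m, h * weight μ (a + (i + 1) * h) ≤
      ∫ x in (a + i * h)..(a + (i + 1) * h), maj μ x := fun i _ => by
    have hab : a + i * h ≤ a + (i + 1) * h := by
      have : ((i : ℝ) + 1) * h = i * h + h := by ring
      linarith [hh.le]
    calc h * weight μ (a + (i + 1) * h) ≤ h * maj μ (a + (i + 1) * h) :=
          mul_le_mul_of_nonneg_left (weight_le_maj hμ0 _) hh.le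
      _ = (a + (i + 1) * h - (a + i * h)) * maj μ (a + (i + 1) * h) := by ring
      _ ≤ _ := mul_maj_le_integral hμ hab
  have hadj := intervalIntegral.sum_integral_adjacent_intervals (μ := volume) (f := maj μ)
    (a := fun k : ℕ => a + (k : ℝ) * h) (n := m)
    (fun k _ => (continuous_maj μ).intervalIntegrable _ _)
  simp only [Nat.cast_zero, zero_mul, add_zero, Nat.cast_add, Nat.cast_one] at hadj
  calc h * ∑ i ∈ Finset.range m, weight μ (a + (i + 1) * h)
        = ∑ i ∈ Finset.range m, h * weight μ (a + (i + 1) * h) := Finset.mul_sum _ _ _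
    _ ≤ ∑ i ∈ Finset.range m, ∫ x in (a + i * h)..(a + (i + 1) * h), maj μ x :=
        Finset.sum_le_sum hcell
    _ = ∫ x in a..(a + m * h), maj μ x := hadj
    _ ≤ 2 * Real.exp (-(2 * (μ * Real.sinh a))) := by
        rw [integral_maj]
        linarith [Real.exp_pos (-(2 * (μ * Real.sinh (a + m * h))))]

/-- The same bound for the left tail (the weight is even). [cite: TakahasiMori1974, Eq. (2.b.12)] -/
theorem mul_sum_weight_neg_le (hμ : 1 / 2 ≤ μ) {h : ℝ} (hh : 0 < h) (a : ℝ) (m : ℕ) :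
    h * ∑ i ∈ Finset.range m, weight μ (-(a + (i + 1) * h)) ≤
      2 * Real.exp (-(2 * (μ * Real.sinh a))) := by
  simpa only [weight_neg] using mul_sum_weight_le hμ hh a m

/-- **Truncation error of the transformed trapezoidal sum, right tail**: for an integrand with
`‖y‖ ≤ M` on `(-1, 1)`, `‖h Σ_{i<m} φ'(a+(i+1)h) y(φ(a+(i+1)h))‖ ≤ 2M e^{-2μ sinh a}`.
[cite: TakahasiMori1974, §2 (a) (`ΔI = ΔI_h + ΔI_t`) and Eq. (2.b.12)];
[cite: TrefethenWeideman2014, §15]. -/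
theorem norm_smul_sum_weight_smul_le (hμ : 1 / 2 ≤ μ) {h : ℝ} (hh : 0 < h) {y : ℝ → F} {M : ℝ}
    (hM : ∀ ξ ∈ Ioo (-1:ℝ) 1, ‖y ξ‖ ≤ M) (a : ℝ) (m : ℕ) :
    ‖h • ∑ i ∈ Finset.range m, weight μ (a + (i + 1) * h) • y (node μ (a + (i + 1) * h))‖ ≤
      2 * M * Real.exp (-(2 * (μ * Real.sinh a))) := by
  have hμ0 : 0 < μ := by linarith
  have hM0 : 0 ≤ M := (norm_nonneg _).trans (hM 0 (by norm_num))
  calc ‖h • ∑ i ∈ Finset.range m, weight μ (a + (i + 1) * h) • y (node μ (a + (i + 1) * h))‖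
        ≤ h * ∑ i ∈ Finset.range m,
            ‖weight μ (a + (i + 1) * h) • y (node μ (a + (i + 1) * h))‖ := by
          rw [norm_smul, Real.norm_of_nonneg hh.le]
          exact mul_le_mul_of_nonneg_left (norm_sum_le _ _) hh.le
    _ ≤ h * ∑ i ∈ Finset.range m, weight μ (a + (i + 1) * h) * M := by
          refine mul_le_mul_of_nonneg_left (Finset.sum_le_sum fun i _ => ?_) hh.le
          rw [norm_smul, Real.norm_of_nonneg (weight_pos hμ0 _).le]
          exact mul_le_mul_of_nonneg_left (hM _ (node_mem_Ioo μ _)) (weight_pos hμ0 _).le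
    _ = M * (h * ∑ i ∈ Finset.range m, weight μ (a + (i + 1) * h)) := by
          rw [← Finset.sum_mul]; ring
    _ ≤ M * (2 * Real.exp (-(2 * (μ * Real.sinh a)))) :=
          mul_le_mul_of_nonneg_left (mul_sum_weight_le hμ hh a m) hM0
    _ = 2 * M * Real.exp (-(2 * (μ * Real.sinh a))) := by ring

/-- … and the left tail. [cite: TakahasiMori1974, Eq. (2.b.12)] -/
theorem norm_smul_sum_weight_smul_neg_le (hμ : 1 / 2 ≤ μ) {h : ℝ} (hh : 0 < h) {y : ℝ → F}
    {M : ℝ} (hM : ∀ ξ ∈ Ioo (-1:ℝ) 1, ‖y ξ‖ ≤ M) (a : ℝ) (m : ℕ) :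
    ‖h • ∑ i ∈ Finset.range m,
        weight μ (-(a + (i + 1) * h)) • y (node μ (-(a + (i + 1) * h)))‖ ≤
      2 * M * Real.exp (-(2 * (μ * Real.sinh a))) := by
  have hM' : ∀ ξ ∈ Ioo (-1:ℝ) 1, ‖(fun ξ => y (-ξ)) ξ‖ ≤ M := fun ξ hξ =>
    hM (-ξ) ⟨by linarith [hξ.2], by linarith [hξ.1]⟩
  simpa only [weight_neg, node_neg] using norm_smul_sum_weight_smul_le hμ hh hM' a m

/-! ### The tanh–sinh rule and its error decomposition -/

/-- The `(2n+1)`-point **tanh–sinh (double exponential) rule** with step `h`: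
`I_h^{(n)}(y) = h Σ_{k=-n}^{n} φ'_μ(kh) · y(φ_μ(kh))`.
[cite: TakahasiMori1974, Eqs. (1.7)–(1.8) with (3.2)–(3.3)];
[cite: TrefethenWeideman2014, Eq. (15.7)]. -/
def deRule (μ h : ℝ) (n : ℕ) (y : ℝ → F) : F :=
  h • ∑ k ∈ Finset.Icc (-(n : ℤ)) n, weight μ (k * h) • y (node μ (k * h))

/-- Symmetric integer ranges as symmetric sums over `ℕ`. [folklore] -/
private theorem sum_Icc_neg_nat_eq {G : Type*} [AddCommMonoid G] (f : ℤ → G) (n : ℕ) :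
    ∑ k ∈ Finset.Icc (-(n : ℤ)) n, f k =
      f 0 + ∑ i ∈ Finset.range n, (f (i + 1) + f (-(i + 1))) := by
  induction n with
  | zero => simp
  | succ n ih =>
    have hIcc : Finset.Icc (-((n + 1 : ℕ) : ℤ)) ((n + 1 : ℕ) : ℤ) =
        insert ((n : ℤ) + 1) (insert (-((n : ℤ) + 1)) (Finset.Icc (-(n : ℤ)) n)) := by
      ext k
      simp only [Finset.mem_Icc, Finset.mem_insert, Nat.cast_add, Nat.cast_one]
      omega
    have h1 : (n : ℤ) + 1 ∉ insert (-((n : ℤ) + 1)) (Finset.Icc (-(n : ℤ)) n) := by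
      simp only [Finset.mem_insert, Finset.mem_Icc]; omega
    have h2 : -((n : ℤ) + 1) ∉ Finset.Icc (-(n : ℤ)) (n : ℤ) := by
      simp only [Finset.mem_Icc]; omega
    rw [hIcc, Finset.sum_insert h1, Finset.sum_insert h2, ih, Finset.sum_range_succ]
    abel

/-- The partial sums `I_h^{(n)}` converge to the infinite trapezoidal sum `h Σ_{k ∈ ℤ}`
(the formula (1.7), of which `I_h^{(n)}` is the truncation) whenever the latter is summable.
[cite: TakahasiMori1974, Eq. (1.7)] -/
theorem tendsto_deRule {h : ℝ} {y : ℝ → F}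
    (hW : Summable fun k : ℤ => weight μ (k * h) • y (node μ (k * h))) :
    Tendsto (fun n : ℕ => deRule μ h n y) atTop
      (𝓝 (h • ∑' k : ℤ, weight μ (k * h) • y (node μ (k * h)))) := by
  have hfin : Tendsto (fun n : ℕ => Finset.Icc (-(n : ℤ)) n) atTop atTop :=
    tendsto_atTop_finset_of_monotone
      (fun a b hab => Finset.Icc_subset_Icc (by simpa using hab) (by simpa using hab))
      (fun k => ⟨k.natAbs, by simp only [Finset.mem_Icc]; omega⟩)
  have ht : Tendsto (fun s : Finset ℤ => ∑ k ∈ s, weight μ (k * h) • y (node μ (k * h))) atTop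
      (𝓝 (∑' k : ℤ, weight μ (k * h) • y (node μ (k * h)))) := hW.hasSum
  exact (ht.comp hfin).const_smul h

/-- **Truncation error of the DE rule** (finite form): enlarging the rule from `n` to `n + m`
points on each side changes it by at most `4M e^{-2μ sinh(nh)}` (`μ ≥ 1/2`, `‖y‖ ≤ M` on
`(-1, 1)`).  [cite: TakahasiMori1974, Eq. (2.b.12)]; [cite: TrefethenWeideman2014, §15]: "The
truncation error can be estimated as" `φ'(nh) = O(exp(-(π/2) e^{nh}))`. -/
theorem norm_deRule_add_sub_deRule_le (hμ : 1 / 2 ≤ μ) {h : ℝ} (hh : 0 < h) {y : ℝ → F}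
    {M : ℝ} (hM : ∀ ξ ∈ Ioo (-1:ℝ) 1, ‖y ξ‖ ≤ M) (n m : ℕ) :
    ‖deRule μ h (n + m) y - deRule μ h n y‖ ≤
      4 * M * Real.exp (-(2 * (μ * Real.sinh (n * h)))) := by
  set W : ℤ → F := fun k => weight μ (k * h) • y (node μ (k * h)) with hW
  have hS : ∀ N : ℕ, deRule μ h N y =
      h • (W 0 + ∑ i ∈ Finset.range N, (W (i + 1) + W (-(i + 1)))) := fun N => by
    rw [← sum_Icc_neg_nat_eq W N]
    simp only [deRule, hW]
  have hsplit : deRule μ h (n + m) y - deRule μ h n y =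
      h • ∑ j ∈ Finset.range m, W (((n + j : ℕ) : ℤ) + 1) +
        h • ∑ j ∈ Finset.range m, W (-(((n + j : ℕ) : ℤ) + 1)) := by
    rw [hS, hS, Finset.sum_range_add, ← smul_sub, ← smul_add, ← Finset.sum_add_distrib]
    congr 1
    abel
  have h1 : ∑ j ∈ Finset.range m, W (((n + j : ℕ) : ℤ) + 1) =
      ∑ j ∈ Finset.range m, weight μ (n * h + (j + 1) * h) • y (node μ (n * h + (j + 1) * h)) :=
    Finset.sum_congr rfl fun j _ => by
      have hc : ((((n + j : ℕ) : ℤ) + 1 : ℤ) : ℝ) * h = n * h + (j + 1) * h := by push_cast; ring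
      simp only [hW, hc]
  have h2 : ∑ j ∈ Finset.range m, W (-(((n + j : ℕ) : ℤ) + 1)) =
      ∑ j ∈ Finset.range m,
        weight μ (-(n * h + (j + 1) * h)) • y (node μ (-(n * h + (j + 1) * h))) :=
    Finset.sum_congr rfl fun j _ => by
      have hc : ((-(((n + j : ℕ) : ℤ) + 1) : ℤ) : ℝ) * h = -(n * h + (j + 1) * h) := by
        push_cast; ring
      simp only [hW, hc]
  rw [hsplit, h1, h2]
  calc _ ≤ _ := norm_add_le _ _
    _ ≤ 2 * M * Real.exp (-(2 * (μ * Real.sinh (n * h)))) +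
          2 * M * Real.exp (-(2 * (μ * Real.sinh (n * h)))) :=
        add_le_add (norm_smul_sum_weight_smul_le hμ hh hM _ m)
          (norm_smul_sum_weight_smul_neg_le hμ hh hM _ m)
    _ = _ := by ring

/-- **Truncation error of the DE rule**: `‖h Σ_{k ∈ ℤ} φ'(kh) y(φ(kh)) - I_h^{(n)}(y)‖ ≤
4M e^{-2μ sinh(nh)}` (`μ ≥ 1/2`, `‖y‖ ≤ M` on `(-1,1)`, the full sum summable).
[cite: TakahasiMori1974, Eq. (2.b.12)]; [cite: TrefethenWeideman2014, §15]. -/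
theorem norm_tsum_sub_deRule_le (hμ : 1 / 2 ≤ μ) {h : ℝ} (hh : 0 < h) {y : ℝ → F} {M : ℝ}
    (hM : ∀ ξ ∈ Ioo (-1:ℝ) 1, ‖y ξ‖ ≤ M)
    (hW : Summable fun k : ℤ => weight μ (k * h) • y (node μ (k * h))) (n : ℕ) :
    ‖h • ∑' k : ℤ, weight μ (k * h) • y (node μ (k * h)) - deRule μ h n y‖ ≤
      4 * M * Real.exp (-(2 * (μ * Real.sinh (n * h)))) := by
  have hnm : Tendsto (fun m : ℕ => n + m) atTop atTop :=
    tendsto_atTop_mono (fun m => Nat.le_add_left m n) tendsto_id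
  have ht := (((tendsto_deRule (μ := μ) hW).comp hnm).sub_const (deRule μ h n y)).norm
  exact le_of_tendsto' ht fun m => norm_deRule_add_sub_deRule_le hμ hh hM n m

/-- **Error decomposition of the tanh–sinh rule**: total error ≤ discretisation error of the
infinite trapezoidal sum on `ℝ` (any bound `δ`, e.g. from
`Literature.Analysis.Quadrature.norm_tsum_sub_integral_le_of_strip`, [cite: TrefethenWeideman2014,
Thm. 5.1]) + truncation error `4M e^{-2μ sinh(nh)}`.
[cite: TakahasiMori1974, §2 (a): `ΔI = ΔI_h + ΔI_t`]; [cite: TrefethenWeideman2014, §15]. -/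
theorem norm_deRule_sub_integral_le (hμ : 1 / 2 ≤ μ) {h : ℝ} (hh : 0 < h) {y : ℝ → F} {M : ℝ}
    (hM : ∀ ξ ∈ Ioo (-1:ℝ) 1, ‖y ξ‖ ≤ M)
    (hW : Summable fun k : ℤ => weight μ (k * h) • y (node μ (k * h))) {δ : ℝ}
    (hδ : ‖h • ∑' k : ℤ, weight μ (k * h) • y (node μ (k * h)) -
      ∫ x, weight μ x • y (node μ x)‖ ≤ δ) (n : ℕ) :
    ‖deRule μ h n y - ∫ ξ in (-1:ℝ)..1, y ξ‖ ≤
      δ + 4 * M * Real.exp (-(2 * (μ * Real.sinh (n * h)))) := by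
  have hμ0 : 0 < μ := by linarith
  rw [← integral_weight_smul_comp_node hμ0 y]
  have h1 := norm_tsum_sub_deRule_le hμ hh hM hW n
  calc ‖deRule μ h n y - ∫ x, weight μ x • y (node μ x)‖
        = ‖(h • ∑' k : ℤ, weight μ (k * h) • y (node μ (k * h)) - ∫ x, weight μ x • y (node μ x)) -
            (h • ∑' k : ℤ, weight μ (k * h) • y (node μ (k * h)) - deRule μ h n y)‖ := by
          congr 1; abel
    _ ≤ _ := norm_sub_le _ _
    _ ≤ _ := add_le_add hδ h1


/-! ### The unit-interval form `x = (1 + φ(t))/2 = 1/(1 + e^{-2μ sinh t}) ∈ (0, 1)`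

The affine image of the map onto `(0, 1)`, i.e. the logistic function of `2μ sinh t`.  With
`μ = π/2`: `x(t) = 1/(1 + e^{-π sinh t})`, `x'(t) = (π/4) cosh t · sech²((π/2) sinh t)`,
`1 - x(t) = x(-t) = e^{-π sinh t}/(1 + e^{-π sinh t})` — the form in which the complement
`1 - x` is available without cancellation ([cite: TakahasiMori1974, Eq. (3.13)]), and the
one-sided truncation tail is `∫_T^∞ x' = 1 - x(T) = 1/(1 + e^{π sinh T})`. -/

/-- The unit-interval DE node `x_μ(t) = (1 + φ_μ(t))/2`. [cite: TakahasiMori1974, Eq. (3.2)] -/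
def unitNode (μ t : ℝ) : ℝ := (1 + node μ t) / 2

/-- Its derivative `x'_μ(t) = φ'_μ(t)/2`. [cite: TakahasiMori1974, Eq. (3.3)] -/
def unitWeight (μ t : ℝ) : ℝ := weight μ t / 2

/-- `x_μ = φ_μ/2 + 1/2`. [cite: TakahasiMori1974, Eq. (3.2)] -/
theorem unitNode_eq_affine (μ t : ℝ) : unitNode μ t = 1 / 2 * node μ t + 1 / 2 := by
  rw [unitNode]; ring

/-- Logistic form `x_μ(t) = 1/(1 + e^{-2μ sinh t})`. [cite: TakahasiMori1974, Eq. (3.13)] -/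
theorem unitNode_eq (μ t : ℝ) :
    unitNode μ t = 1 / (1 + Real.exp (-(2 * (μ * Real.sinh t)))) := by
  have hE := Real.exp_pos (-(2 * (μ * Real.sinh t)))
  rw [unitNode, one_add_node']
  field_simp
  ring

/-- `x_μ(t) = e^{2μ sinh t}/(e^{2μ sinh t} + 1)` (the same function, written for `t < 0`).
[cite: TakahasiMori1974, Eq. (3.13)] -/
theorem unitNode_eq' (μ t : ℝ) :
    unitNode μ t = Real.exp (2 * (μ * Real.sinh t)) / (Real.exp (2 * (μ * Real.sinh t)) + 1) := by
  have hE' : 0 < Real.exp (2 * (μ * Real.sinh t)) + 1 := by positivity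
  have hmul : Real.exp (2 * (μ * Real.sinh t)) * Real.exp (-(2 * (μ * Real.sinh t))) = 1 := by
    rw [← Real.exp_add, add_neg_cancel, Real.exp_zero]
  rw [unitNode_eq, div_eq_div_iff (by positivity) hE'.ne', one_mul, mul_add, mul_one, hmul]

/-- **The complement is the reflected node**: `1 - x_μ(t) = x_μ(-t)` (so a node table on `t ≥ 0`
read backwards is the table of complements `1 - x`). [cite: TakahasiMori1974, Eq. (3.13)] -/
theorem one_sub_unitNode (μ t : ℝ) : 1 - unitNode μ t = unitNode μ (-t) := by
  simp only [unitNode, node_neg]; ring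

/-- `1 - x_μ(t) = e^{-2μ sinh t}/(1 + e^{-2μ sinh t})`, computable without cancellation for
large `t`. [cite: TakahasiMori1974, Eq. (3.13)] -/
theorem one_sub_unitNode_eq (μ t : ℝ) :
    1 - unitNode μ t =
      Real.exp (-(2 * (μ * Real.sinh t))) / (1 + Real.exp (-(2 * (μ * Real.sinh t)))) := by
  rw [one_sub_unitNode, unitNode_eq', Real.sinh_neg, mul_neg, mul_neg, add_comm]

/-- `1 - x_μ(t) = 1/(1 + e^{2μ sinh t})`: the size of the one-sided truncation tail
`∫_t^∞ x'_μ`. [cite: TakahasiMori1974, Eqs. (3.13), (2.b.12)] -/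
theorem one_sub_unitNode_eq_inv (μ t : ℝ) :
    1 - unitNode μ t = 1 / (1 + Real.exp (2 * (μ * Real.sinh t))) := by
  rw [one_sub_unitNode, unitNode_eq, Real.sinh_neg, mul_neg, mul_neg, neg_neg]

/-- `x_μ(t) ∈ (0, 1)`. [cite: TakahasiMori1974, Eq. (3.13)] -/
theorem unitNode_mem_Ioo (μ t : ℝ) : unitNode μ t ∈ Ioo 0 1 := by
  have h := node_mem_Ioo μ t
  simp only [unitNode, mem_Ioo] at h ⊢
  constructor <;> linarith [h.1, h.2]

/-- `0 < x_μ(t)`. [cite: TakahasiMori1974, Eq. (3.13)] -/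
theorem unitNode_pos (μ t : ℝ) : 0 < unitNode μ t := (unitNode_mem_Ioo μ t).1

/-- `x_μ(t) < 1`. [cite: TakahasiMori1974, Eq. (3.13)] -/
theorem unitNode_lt_one (μ t : ℝ) : unitNode μ t < 1 := (unitNode_mem_Ioo μ t).2

/-- `x_μ(0) = 1/2` (the midpoint node). [cite: TakahasiMori1974, Eq. (3.2)] -/
theorem unitNode_zero (μ : ℝ) : unitNode μ 0 = 1 / 2 := by simp [unitNode]

/-- `x'_μ(t) = (μ/2) cosh t / cosh²(μ sinh t)` (`= (π/4) cosh t · sech²((π/2) sinh t)` for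
`μ = π/2`). [cite: TakahasiMori1974, Eq. (3.3)] -/
theorem unitWeight_eq (μ t : ℝ) :
    unitWeight μ t = μ / 2 * Real.cosh t / Real.cosh (μ * Real.sinh t) ^ 2 := by
  simp only [unitWeight, weight]; ring

/-- `dx_μ/dt = x'_μ`. [cite: TakahasiMori1974, Eq. (3.3)] -/
theorem hasDerivAt_unitNode (μ t : ℝ) : HasDerivAt (unitNode μ) (unitWeight μ t) t := by
  have h := ((hasDerivAt_node μ t).const_add 1).div_const 2
  exact h

/-- The unit weights are positive (`μ > 0`). [cite: TakahasiMori1974, Eq. (3.3)] -/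
theorem unitWeight_pos (hμ : 0 < μ) (t : ℝ) : 0 < unitWeight μ t := by
  unfold unitWeight; exact div_pos (weight_pos hμ t) two_pos

/-- The unit weight is even. [cite: TakahasiMori1974, Eq. (3.3)] -/
theorem unitWeight_neg (μ t : ℝ) : unitWeight μ (-t) = unitWeight μ t := by
  simp only [unitWeight, weight_neg]

/-- `x_μ` is strictly increasing (`μ > 0`). [cite: TakahasiMori1974, Eq. (3.2)] -/
theorem strictMono_unitNode (hμ : 0 < μ) : StrictMono (unitNode μ) := fun a b hab => by
  simp only [unitNode]
  linarith [strictMono_node hμ hab]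

/-- The unit weight is continuous. [cite: TakahasiMori1974, Eq. (3.3)] -/
theorem continuous_unitWeight (μ : ℝ) : Continuous (unitWeight μ) :=
  (continuous_weight μ).div_const 2

/-- `∫_{-∞}^{∞} x'_μ = 1` (the weights of the unit-interval rule integrate to the length of
`[0, 1]`). [cite: TrefethenWeideman2014, Eq. (15.11)] -/
theorem integral_unitWeight (hμ : 0 < μ) : ∫ t, unitWeight μ t = 1 := by
  simp only [unitWeight, integral_div, integral_weight hμ]
  norm_num

/-- The unit weight is integrable on `ℝ`. [cite: TrefethenWeideman2014, Eq. (15.11)] -/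
theorem integrable_unitWeight (hμ : 0 < μ) : Integrable (unitWeight μ) :=
  (integrable_weight hμ).div_const 2

/-- One-sided truncation of the unit-interval rule: `∫_T^∞ x'_μ = 1 - x_μ(T) = 1/(1+e^{2μ sinh T})`.
[cite: TakahasiMori1974, Eq. (2.b.12)] -/
theorem integral_unitWeight_Ioi (hμ : 0 < μ) (T : ℝ) :
    ∫ t in Ioi T, unitWeight μ t = 1 - unitNode μ T := by
  simp only [unitWeight, integral_div, integral_weight_Ioi hμ, unitNode]
  ring

/-- **Change of variables onto `[0, 1]`**: `∫_0^1 g(x) dx = ∫_{-∞}^{∞} g(x_μ(t)) x'_μ(t) dt`.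
[cite: TrefethenWeideman2014, Eq. (15.1)]; [cite: TakahasiMori1974, Eqs. (1.4)–(1.5), (3.2)]. -/
theorem integral_unitWeight_smul_comp_unitNode (hμ : 0 < μ) (g : ℝ → F) :
    ∫ t, unitWeight μ t • g (unitNode μ t) = ∫ x in (0:ℝ)..1, g x := by
  have hpt : ∀ t, unitWeight μ t • g (unitNode μ t) =
      (1 / 2 : ℝ) • (weight μ t • g (1 / 2 * node μ t + 1 / 2)) := fun t => by
    rw [unitNode_eq_affine, unitWeight, smul_smul]
    congr 1
    ring
  simp_rw [hpt]
  rw [integral_smul, integral_weight_smul_comp_node hμ (fun ξ => g (1 / 2 * ξ + 1 / 2)),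
    intervalIntegral.integral_comp_mul_add (fun x => g x) (by norm_num : (1 / 2 : ℝ) ≠ 0),
    smul_smul]
  norm_num

/-- Right tail of the trapezoidal sum of the unit weights:
`h Σ_{i<m} x'_μ(a+(i+1)h) ≤ e^{-2μ sinh a}` (`μ ≥ 1/2`, `h > 0`).
[cite: TakahasiMori1974, Eq. (2.b.12)] -/
theorem mul_sum_unitWeight_le (hμ : 1 / 2 ≤ μ) {h : ℝ} (hh : 0 < h) (a : ℝ) (m : ℕ) :
    h * ∑ i ∈ Finset.range m, unitWeight μ (a + (i + 1) * h) ≤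
      Real.exp (-(2 * (μ * Real.sinh a))) := by
  have h1 := mul_sum_weight_le hμ hh a m
  simp only [unitWeight, ← Finset.sum_div, mul_div_assoc'] 
  linarith

/-! ### The standard choice `μ = π/2` -/

/-- `x_{π/2}(t) = 1/(1 + e^{-π sinh t})`. [cite: TakahasiMori1974, Eqs. (3.2), (3.13)] -/
theorem unitNode_pi_div_two (t : ℝ) :
    unitNode (π / 2) t = 1 / (1 + Real.exp (-(π * Real.sinh t))) := by
  rw [unitNode_eq]; congr 3; ring

/-- `1 - x_{π/2}(t) = e^{-π sinh t}/(1 + e^{-π sinh t})`. [cite: TakahasiMori1974, Eq. (3.13)] -/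
theorem one_sub_unitNode_pi_div_two (t : ℝ) :
    1 - unitNode (π / 2) t =
      Real.exp (-(π * Real.sinh t)) / (1 + Real.exp (-(π * Real.sinh t))) := by
  rw [one_sub_unitNode_eq]
  have : 2 * (π / 2 * Real.sinh t) = π * Real.sinh t := by ring
  rw [this]

/-- `x'_{π/2}(t) = (π/4) cosh t / cosh²((π/2) sinh t)`. [cite: TakahasiMori1974, Eq. (3.3)] -/
theorem unitWeight_pi_div_two (t : ℝ) :
    unitWeight (π / 2) t = π / 4 * Real.cosh t / Real.cosh (π / 2 * Real.sinh t) ^ 2 := by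
  rw [unitWeight_eq]; ring

/-- `1 - φ_{π/2}(x) ≤ 2 e^{-π sinh x} ≤ 2 e^{π/2} exp(-(π/2) eˣ)` for `x ≥ 0`: the transformed
integrand decays double exponentially. [cite: TakahasiMori1974, Eqs. (3.14), (2.b.12)];
[cite: TrefethenWeideman2014, §15]. -/
theorem one_sub_node_pi_div_two_le {x : ℝ} (hx : 0 ≤ x) :
    1 - node (π / 2) x ≤ 2 * (Real.exp (π / 2) * Real.exp (-(π / 2 * Real.exp x))) :=
  (one_sub_node_le _ x).trans (mul_le_mul_of_nonneg_left
    (exp_neg_two_mul_sinh_le (by positivity) hx) zero_le_two)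

end

end Literature.Analysis.Quadrature.TanhSinh
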